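import Literature.Analysis.FunctionSpaces.TorusLineHardy
import Literature.Analysis.FunctionSpaces.TorusPairDist
import HarnessLib

/-!
# Hardy's inequality near a hard-core pair tube on the torus `(ℝ/ℤ)^{N×3}`

Analysis/FunctionSpaces support file (everything proved; no definitions, no named facts; global
`volume` convention of `FlatTorus`). For `N` particles on the unit torus and a pair `i ≠ j` with
nearest-image pair distance `ρᵢⱼ = Torus.pairDist i j` (`TorusPairDist`), the hard-core tube of
radius `r` is `{ρᵢⱼ < r}`; a function vanishing a.e. on it and lying in the spectral `H¹` along the
three coordinates of particle `i` satisfies the **tube Hardy inequality** on the collar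
`{r < ρᵢⱼ < 6r/5}`:

  `∫⁻_{r < ρᵢⱼ < 6r/5} ‖g‖² / (ρᵢⱼ - r)² ≤ 96 ∑ₖ ‖∂_{(i,k)} g‖₂²`     (`Torus.lintegral_collar_div_sq_le`),

the form in which Hardy's inequality enters the maximal-form bound / absence of a Lavrentiev gap for
hard-core Bose gases (cutting off an `H¹` function at distance `δ` from the hard core costs
`O(∫_{dist < 2δ} |g|²/dist²) → 0`). Proof: at a point of the collar let `k` carry a third of `ρ²`;
moving the coordinate `(i,k)` towards the tube by at most `2√3 (ρᵢⱼ - r)` enters the open tube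
(`Torus.exists_single_mem_tube`: the coordinate line meets the ball in a chord since
`‖yₖ‖² ≥ ρ²/3 > ρ² - r²`), so `1/(ρᵢⱼ - r)² ≤ 12/ρₖ²` with `ρₖ` the directional distance of
`TorusLineHardy`, and the directional Hardy inequality `Torus.lintegral_enorm_sq_div_lineDist_sq_le`
(constant `8`) in the three directions gives `96`.

## Mathlib / tree search

Mathlib: `Metric.infDist_le_dist_of_mem`, `MeasureTheory.lintegral_iUnion_le`; nothing on pair tubes /
hard cores. Tree: `TorusPairDist` (pair distance), `TorusLineHardy` (directional Hardy),
`TorusLineAbsContinuity` (ACL).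

## References

* V. Maz'ya, *Sobolev Spaces*, 2nd ed., Springer (2011), §2.3.3.
* E. H. Lieb, R. Seiringer, J. P. Solovej, J. Yngvason, *The Mathematics of the Bose Gas and its
  Condensation*, Birkhäuser (2005), Ch. 2 (hard-core boundary conditions on pair tubes).
-/

noncomputable section

open MeasureTheory Set Filter Function UnitAddTorus Metric
open scoped ENNReal NNReal Topology

namespace Literature.Analysis.FunctionSpaces

namespace Torus

variable {N : ℕ}

/-! ## A coordinate line from the collar enters the tube -/

/-- **From a point of the collar, a good coordinate line enters the open tube nearby.** If `i ≠ j`,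
`0 < r < ρ := pairDist i j t < 6r/5` and the coordinate `k` carries a third of `ρ²`
(`ρ² ≤ 3 ‖t(i,k) - t(j,k)‖²`, e.g. the largest one), there is a real `s` with
`|s| ≤ 2√3 (ρ - r)` and `pairDist i j (t + s𝐞_{(i,k)}) < r`: with `m = ‖t(i,k) - t(j,k)‖`, a lift `x`
of that coordinate with `|x| = m`, move it towards `0` by `σ = min m (2√3 (ρ - r))`; then
`ρ² - m² + (m - σ)² < r²`. [folklore] -/
theorem exists_single_mem_tube {i j : Fin N} (hij : i ≠ j) {r : ℝ} (hr : 0 < r)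
    {t : UnitAddTorus (Fin N × Fin 3)} (h₁ : r < pairDist i j t) (h₂ : pairDist i j t < 6 / 5 * r)
    {k : Fin 3} (hthird : pairDist i j t ^ 2 ≤ 3 * ‖t (i, k) - t (j, k)‖ ^ 2) :
    ∃ s : ℝ, |s| ≤ 2 * Real.sqrt 3 * (pairDist i j t - r) ∧
      pairDist i j (t + Pi.single (i, k) ((s : ℝ) : UnitAddCircle)) < r := by
  set ρ := pairDist i j t with hρ_def
  set m := ‖t (i, k) - t (j, k)‖ with hm_def
  obtain ⟨x, hx, hxm⟩ := UnitAddCircle.exists_lift_abs_eq_norm (t (i, k) - t (j, k))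
  rw [← hm_def] at hxm
  have hρ0 : 0 < ρ := hr.trans h₁
  have hm0 : 0 ≤ m := norm_nonneg _
  have h3 : (0 : ℝ) < Real.sqrt 3 := Real.sqrt_pos.2 (by norm_num)
  have hsq3 : Real.sqrt 3 ^ 2 = 3 := Real.sq_sqrt (by norm_num)
  -- `m ≥ ρ/√3`
  have hmρ : ρ ≤ Real.sqrt 3 * m := by
    have h1 : ρ ^ 2 ≤ (Real.sqrt 3 * m) ^ 2 := by rw [mul_pow, hsq3]; exact hthird
    exact (pow_le_pow_iff_left₀ hρ0.le (mul_nonneg h3.le hm0) two_ne_zero).1 h1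
  -- the step `σ` and the shift `s`
  set σ := min m (2 * Real.sqrt 3 * (ρ - r)) with hσ_def
  have hσ0 : 0 ≤ σ :=
    le_min hm0 (mul_nonneg (mul_nonneg zero_le_two h3.le) (sub_nonneg.2 h₁.le))
  have hσm : σ ≤ m := min_le_left _ _
  have hσb : σ ≤ 2 * Real.sqrt 3 * (ρ - r) := min_le_right _ _
  set s : ℝ := if 0 ≤ x then -σ else σ with hs_def
  have hs_abs : |s| = σ := by
    simp only [hs_def]; split_ifs <;> simp [abs_of_nonneg hσ0]
  have hxs : |x + s| = m - σ := by
    simp only [hs_def]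
    split_ifs with hx0
    · rw [abs_of_nonneg hx0] at hxm
      rw [← sub_eq_add_neg, abs_of_nonneg (by linarith), hxm]
    · rw [abs_of_neg (not_le.1 hx0)] at hxm
      rw [abs_of_nonpos (by linarith)]
      linarith
  refine ⟨s, hs_abs ▸ hσb, ?_⟩
  -- the new pair coordinates
  set t' := t + Pi.single (i, k) ((s : ℝ) : UnitAddCircle) with ht'_def
  have hcoord : ∀ k', t' (i, k') - t' (j, k') =
      t (i, k') - t (j, k') + if k' = k then ((s : ℝ) : UnitAddCircle) else 0 :=
    fun k' => pair_coord_add_single hij t k k' _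
  have hk' : ∀ k', k' ≠ k → ‖t' (i, k') - t' (j, k')‖ = ‖t (i, k') - t (j, k')‖ := fun k' hk' => by
    rw [hcoord k', if_neg hk', add_zero]
  have hkk : ‖t' (i, k) - t' (j, k)‖ ≤ m - σ := by
    rw [hcoord k, if_pos rfl, ← hx, ← AddCircle.coe_add, ← hxs]
    exact UnitAddCircle.norm_coe_le_abs _
  -- `pairDist t'² ≤ ρ² - m² + (m - σ)²`
  have hsum : pairDist i j t' ^ 2 + m ^ 2 ≤ ρ ^ 2 + (m - σ) ^ 2 := by
    rw [pairDist_sq, hρ_def, pairDist_sq]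
    have hterm : ∀ k', ‖t' (i, k') - t' (j, k')‖ ^ 2 + (if k' = k then m ^ 2 else 0) ≤
        ‖t (i, k') - t (j, k')‖ ^ 2 + (if k' = k then (m - σ) ^ 2 else 0) := by
      intro k'
      by_cases hk'' : k' = k
      · rw [if_pos hk'', if_pos hk'', hk'', ← hm_def]
        nlinarith [hkk, norm_nonneg (t' (i, k) - t' (j, k)), hσm]
      · rw [if_neg hk'', if_neg hk'', hk' k' hk'']
    have h := Finset.sum_le_sum fun k' (_ : k' ∈ Finset.univ) => hterm k'
    simp only [Finset.sum_add_distrib, Finset.sum_ite_eq', Finset.mem_univ, if_true] at h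
    exact h
  -- `(m - σ)² < q = r² - ρ² + m²`
  have hkey : (m - σ) ^ 2 < r ^ 2 - ρ ^ 2 + m ^ 2 := by
    rcases le_total m (2 * Real.sqrt 3 * (ρ - r)) with hcase | hcase
    · -- `σ = m`
      have hσ : σ = m := min_eq_left hcase
      rw [hσ, sub_self, zero_pow two_ne_zero]
      -- `q > 0`: `r² - ρ² + m² ≥ r² - (2/3) ρ² > 0`
      have hρr : ρ ^ 2 < (6 / 5 * r) ^ 2 := pow_lt_pow_left₀ h₂ hρ0.le two_ne_zero
      nlinarith [hthird, hρr, hr]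
    · -- `σ = 2√3 (ρ - r)`
      have hσ : σ = 2 * Real.sqrt 3 * (ρ - r) := min_eq_right hcase
      -- `ρ² - r² < σ (2m - σ)` since `2m - σ ≥ m ≥ ρ/√3`
      have hA : σ * (ρ / Real.sqrt 3) ≤ σ * (2 * m - σ) :=
        mul_le_mul_of_nonneg_left (by rw [div_le_iff₀ h3]; nlinarith [hmρ, hcase]) hσ0
      have hB : σ * (ρ / Real.sqrt 3) = 2 * ρ * (ρ - r) := by
        rw [hσ]; field_simp
      nlinarith [hA, hB, sq_pos_of_pos (sub_pos.2 h₁)]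
  have hlt : pairDist i j t' ^ 2 < r ^ 2 := by linarith
  exact (pow_lt_pow_iff_left₀ (pairDist_nonneg i j t') hr.le two_ne_zero).1 hlt

/-! ## The tube Hardy inequality -/

section Hardy

variable {F : Type*} [NormedAddCommGroup F] [NormedSpace ℂ F] [CompleteSpace F]

/-- **Hardy's inequality on the collar of a hard-core pair tube.** Let `i ≠ j`, `0 < r`,
`g ∈ L¹((ℝ/ℤ)^{N×3}; F)` with weak derivatives `hₖ ∈ L¹` along the three coordinates of particle
`i` (`𝓕hₖ(n) = 2πi n_{(i,k)} ĝ(n)`), and `g = 0` a.e. on the open tube `{pairDist i j < r}`. Then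

  `∫⁻_{r < pairDist < 6r/5} ‖g‖² / (pairDist - r)² ≤ 96 ∑ₖ ∫⁻ ‖hₖ‖²`.

(For `g` in the spectral `H¹`, `∫⁻ ‖hₖ‖² = 4π² ∑ₙ n_{(i,k)}² ‖ĝ(n)‖²`,
`Torus.exists_lineDeriv_of_tsum_ne_top`.) [folklore] -/
theorem lintegral_collar_div_sq_le {i j : Fin N} (hij : i ≠ j) {r : ℝ} (hr : 0 < r)
    {g : UnitAddTorus (Fin N × Fin 3) → F} (hg : Integrable g volume)
    {h : Fin 3 → UnitAddTorus (Fin N × Fin 3) → F} (hh : ∀ k, Integrable (h k) volume)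
    (hcoeff : ∀ k (n : Fin N × Fin 3 → ℤ),
      mFourierCoeff (h k) n = (2 * Real.pi * Complex.I * (n (i, k))) • mFourierCoeff g n)
    (hgZ : ∀ᵐ t ∂(volume : Measure (UnitAddTorus (Fin N × Fin 3))), pairDist i j t < r → g t = 0) :
    ∫⁻ t in {t | r < pairDist i j t ∧ pairDist i j t < 6 / 5 * r},
        ‖g t‖ₑ ^ 2 / ENNReal.ofReal ((pairDist i j t - r) ^ 2) ≤
      96 * ∑ k : Fin 3, ∫⁻ t, ‖h k t‖ₑ ^ 2 := by
  set Z : Set (UnitAddTorus (Fin N × Fin 3)) := {t | pairDist i j t < r} with hZ_def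
  have hZ : IsOpen Z := isOpen_lt (continuous_pairDist i j) continuous_const
  set C : Set (UnitAddTorus (Fin N × Fin 3)) := {t | r < pairDist i j t ∧ pairDist i j t < 6 / 5 * r} with hC_def
  have hC : MeasurableSet C :=
    (measurableSet_lt measurable_const (continuous_pairDist i j).measurable).inter
      (measurableSet_lt (continuous_pairDist i j).measurable measurable_const)
  -- the pieces of the collar where `k` is a good direction
  set A : Fin 3 → Set (UnitAddTorus (Fin N × Fin 3)) := fun k =>
    C ∩ {t | pairDist i j t ^ 2 ≤ 3 * ‖t (i, k) - t (j, k)‖ ^ 2} with hA_def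
  have hA : ∀ k, MeasurableSet (A k) := fun k =>
    hC.inter (measurableSet_le ((continuous_pairDist i j).measurable.pow_const 2)
      (by fun_prop : Measurable fun t : UnitAddTorus (Fin N × Fin 3) => 3 * ‖t (i, k) - t (j, k)‖ ^ 2))
  have hcover : C ⊆ ⋃ k, A k := by
    intro t ht
    obtain ⟨k, -, hk⟩ := exists_third_le_norm_sq i j t
    exact mem_iUnion.2 ⟨k, ht, hk⟩
  -- the directional integrands
  set M : Fin 3 → Set (UnitAddTorus (Fin N × Fin 3)) := fun k =>
    {y | ∃ s : ℝ, y + Pi.single (i, k) ((s : ℝ) : UnitAddCircle) ∈ Z} with hM_def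
  set ρ : Fin 3 → UnitAddTorus (Fin N × Fin 3) → ℝ := fun k y =>
    infDist (0 : ℝ) {s : ℝ | y + Pi.single (i, k) ((s : ℝ) : UnitAddCircle) ∈ Z} with hρ_def
  -- pointwise comparison on `A k`
  have hpt : ∀ k, ∀ t ∈ A k, ‖g t‖ₑ ^ 2 / ENNReal.ofReal ((pairDist i j t - r) ^ 2) ≤
      12 * (‖g t‖ₑ ^ 2 / ENNReal.ofReal (ρ k t ^ 2)) := by
    rintro k t ⟨htC, hk⟩
    obtain ⟨s, hs, hsZ⟩ := exists_single_mem_tube hij hr htC.1 htC.2 hk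
    have hρle : ρ k t ≤ |s| := by
      have := infDist_le_dist_of_mem (x := (0 : ℝ)) (show s ∈ {s : ℝ | t + Pi.single (i, k) ((s : ℝ) : UnitAddCircle) ∈ Z} from hsZ)
      rwa [Real.dist_eq, zero_sub, abs_neg] at this
    have hρ0 : 0 ≤ ρ k t := infDist_nonneg
    have hρsq : ENNReal.ofReal (ρ k t ^ 2) ≤ 12 * ENNReal.ofReal ((pairDist i j t - r) ^ 2) := by
      rw [show (12 : ℝ≥0∞) = ENNReal.ofReal 12 by norm_num, ← ENNReal.ofReal_mul (by norm_num)]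
      refine ENNReal.ofReal_le_ofReal ?_
      have h1 : ρ k t ≤ 2 * Real.sqrt 3 * (pairDist i j t - r) := hρle.trans hs
      have h2 : (2 * Real.sqrt 3 * (pairDist i j t - r)) ^ 2 = 12 * (pairDist i j t - r) ^ 2 := by
        rw [mul_pow, mul_pow, Real.sq_sqrt (by norm_num)]; ring
      rw [← h2]
      exact pow_le_pow_left₀ hρ0 h1 2
    rw [ENNReal.div_eq_inv_mul, ENNReal.div_eq_inv_mul, ← mul_assoc]
    refine mul_le_mul_left ?_ _
    calc (ENNReal.ofReal ((pairDist i j t - r) ^ 2))⁻¹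
        = 12 * (12 * ENNReal.ofReal ((pairDist i j t - r) ^ 2))⁻¹ := by
          rw [ENNReal.mul_inv (Or.inl (by norm_num)) (Or.inl (by norm_num)), ← mul_assoc,
            ENNReal.mul_inv_cancel (by norm_num) (by norm_num), one_mul]
      _ ≤ 12 * (ENNReal.ofReal (ρ k t ^ 2))⁻¹ := mul_le_mul_right (ENNReal.inv_le_inv.2 hρsq) _
  -- the directional Hardy inequality in each direction
  have hdir : ∀ k, ∫⁻ t in M k, ‖g t‖ₑ ^ 2 / ENNReal.ofReal (ρ k t ^ 2) ≤ 8 * ∫⁻ t, ‖h k t‖ₑ ^ 2 :=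
    fun k => lintegral_enorm_sq_div_lineDist_sq_le (i, k) hg (hh k) (hcoeff k) hZ hgZ
  -- assemble
  calc ∫⁻ t in C, ‖g t‖ₑ ^ 2 / ENNReal.ofReal ((pairDist i j t - r) ^ 2)
      ≤ ∫⁻ t in ⋃ k, A k, ‖g t‖ₑ ^ 2 / ENNReal.ofReal ((pairDist i j t - r) ^ 2) :=
        lintegral_mono_set hcover
    _ ≤ ∑' k, ∫⁻ t in A k, ‖g t‖ₑ ^ 2 / ENNReal.ofReal ((pairDist i j t - r) ^ 2) :=
        lintegral_iUnion_le _ _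
    _ = ∑ k, ∫⁻ t in A k, ‖g t‖ₑ ^ 2 / ENNReal.ofReal ((pairDist i j t - r) ^ 2) := tsum_fintype _
    _ ≤ ∑ k, 12 * (8 * ∫⁻ t, ‖h k t‖ₑ ^ 2) := by
        refine Finset.sum_le_sum fun k _ => ?_
        have hAM : A k ⊆ M k := fun t ht =>
          (exists_single_mem_tube hij hr ht.1.1 ht.1.2 ht.2).imp fun s hs => hs.2
        calc ∫⁻ t in A k, ‖g t‖ₑ ^ 2 / ENNReal.ofReal ((pairDist i j t - r) ^ 2)
            ≤ ∫⁻ t in A k, 12 * (‖g t‖ₑ ^ 2 / ENNReal.ofReal (ρ k t ^ 2)) :=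
              setLIntegral_mono' (hA k) (hpt k)
          _ = 12 * ∫⁻ t in A k, ‖g t‖ₑ ^ 2 / ENNReal.ofReal (ρ k t ^ 2) :=
              lintegral_const_mul' _ _ (by norm_num)
          _ ≤ 12 * ∫⁻ t in M k, ‖g t‖ₑ ^ 2 / ENNReal.ofReal (ρ k t ^ 2) :=
              mul_le_mul_right (lintegral_mono_set hAM) _
          _ ≤ 12 * (8 * ∫⁻ t, ‖h k t‖ₑ ^ 2) := mul_le_mul_right (hdir k) _
    _ = 96 * ∑ k : Fin 3, ∫⁻ t, ‖h k t‖ₑ ^ 2 := by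
        rw [Finset.mul_sum]
        refine Finset.sum_congr rfl fun k _ => ?_
        rw [← mul_assoc]
        norm_num

end Hardy

end Torus

end Literature.Analysis.FunctionSpaces

end
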